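import Mathlib.Dynamics.Ergodic.MeasurePreserving
import Mathlib.MeasureTheory.Measure.WithDensity
import Mathlib.Topology.Order.LeftRightLim
import Literature.Analysis.FluidPDE.HardSpherePhaseSpace
import HarnessLib

-- provenance: harness21/H21/H21/Prelude/FluidKinetic/HardSphereDynamics.lean @ f1218b6 (interim HEAD d8f2665); M5 mechanical rewrite
/-!
# Hard-sphere dynamics (trunk: FluidKinetic / T-KINETIC, item K2; notion `hard_sphere_dynamics`)

The `N`-particle hard-sphere flow on the phase space `Kinetic.Config N d X` of
`Literature.Prelude.FluidKinetic.HardSpherePhaseSpace`: particles move by free flight in the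
hard-sphere domain `D_ε^N` and, when two of them come into contact with incoming velocities,
their velocities jump by the elastic reflection law (Gallagher–Saint-Raymond–Texier 2013 §1.1,
Prop. 4.1.1, §4.2; Cercignani–Illner–Pulvirenti 1994 §4.2 and App. 4.A; Alexander 1975).

* `Kinetic.IsHardSphereTrajectory G ε N γ`: the curve `γ : ℝ → Config N d X` is a hard-sphere
  trajectory — it stays in `D_ε^N`, its collision times are locally finite, positions are
  continuous, it is free flight between collisions, and at each collision time exactly one pair
  is in contact, the left limit is pre-collisional and the (right-continuous) value is its
  elastic reflection. Grazing and multiple collisions are excluded (they are Liouville-null,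
  GST 2013 Prop. 4.1.1).
* `Kinetic.HardSphereFlow G ε N`: a *hypothesis structure* bundling the almost-everywhere defined
  global flow (Alexander's theorem): a full-measure invariant measurable good set on which the
  flow is a group of hard-sphere trajectories preserving the Liouville measure. Its existence is
  the (sorried) theorem `HardSphereFlow.nonempty` (`ℝ^d`) / `HardSphereFlow.nonempty_torus`
  (`T^d`); the statement files restate the torus version with its inventory id.
* transport of densities / laws along the flow (`transportDensity`, `transportFn`, `lawAt`), the
  number of collisions `numCollisions`, the velocity flip `flipVel` and time reversal.

## Mathlib / H21 reuse

`MeasureTheory.MeasurePreserving`, `Measure.map`, `Measure.withDensity`, `Filter.Tendsto`,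
`nhdsWithin` (`𝓝[<] t`), `Function.leftLim`, `Set.Finite`, `Set.ncard` are Mathlib's. Mathlib
has no billiard / hard-sphere flow (grep `billiard|hard.?sphere`: nothing); flows in
`Mathlib.Dynamics.Flow` are everywhere-defined continuous actions, which the hard-sphere flow is
not (it is defined Liouville-a.e. and is discontinuous in the initial datum), so we do not use
`Flow`.

## Design choices

* Trajectories are *right-continuous* at collision times (`γ t` is the post-collisional
  configuration, the pre-collisional one is the left limit), matching GST 2013 §4.1.
* `HardSphereFlow` is a structure of hypotheses, not a definition by construction: the
  construction (Alexander 1975; GST 2013 Prop. 4.1.1; CIP 1994 App. 4.A) is research-level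
  measure theory and only its *properties* are consumed downstream (BBGKY, Lanford).
* `HardSphereFlow.nonempty` is stated for the two concrete geometries only: for an abstract
  `Geometry` (no measurability / continuity axioms) it would be false.
* `IsHardSphereTrajectory.unique` is forward uniqueness (`EqOn` on `Ici t₀`) and assumes
  `[T2Space X]` (otherwise left limits / positions are not determined and it fails); backward
  uniqueness needs moreover continuity of the translation action, which an abstract `Geometry`
  lacks. `HardSphereFlow.flow_eq_ae` likewise assumes `[T2Space X]`.
* Time reversal uses `Function.leftLim` to restore right-continuity of the reversed path; the
  closure theorem `IsHardSphereTrajectory.timeReverse` assumes `[T2Space X]` and continuity of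
  each `G.translate x` (true for `Euclidean.geometry`, `Torus.geometry`), without which it
  fails.

## References

* R. K. Alexander, *The infinite hard sphere system*, PhD thesis, Berkeley (1975).
* I. Gallagher, L. Saint-Raymond, B. Texier, *From Newton to Boltzmann* (2013), Prop. 4.1.1,
  Def. 4.1.2, §4.2.
* C. Cercignani, R. Illner, M. Pulvirenti, *The Mathematical Theory of Dilute Gases* (1994),
  §4.2, Appendix 4.A.
-/

open MeasureTheory Set Filter Topology
open scoped ENNReal

namespace Literature.Analysis.FluidPDE

noncomputable section

section Kinetic

variable {d : Type*} [Fintype d] {X : Type*} {N : ℕ}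

/-! ## Collision times and the velocity flip -/

/-- The set of collision (contact) times of a curve `γ` in phase space: times `t` at which some
pair `i ≠ j` is in contact, `γ t ∈ contactSet G N ε i j` (GST 2013 §4.1). [cite: GST2013, §4.1] -/
def collisionTimes (G : Geometry d X) (ε : ℝ) (γ : ℝ → Config N d X) : Set ℝ :=
  {t | ∃ i j : Fin N, i ≠ j ∧ γ t ∈ contactSet G N ε i j}

/-- Membership in the set of collision times. [folklore] -/
theorem mem_collisionTimes {G : Geometry d X} {ε : ℝ} {γ : ℝ → Config N d X} {t : ℝ} :
    t ∈ collisionTimes G ε γ ↔ ∃ i j : Fin N, i ≠ j ∧ γ t ∈ contactSet G N ε i j :=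
  Iff.rfl

/-- The number of collisions of the curve `γ` in the time window `[a, b]`: the cardinality of
`collisionTimes G ε γ ∩ Icc a b` (`Set.ncard`, hence the junk value `0` if this set is
infinite — it is finite for a hard-sphere trajectory, `IsHardSphereTrajectory.locFinite`)
(GST 2013 Prop. 4.1.1: finitely many collisions in finite time, a.e.). [cite: GST2013, Prop. 4.1.1: finitely many collisions in] -/
def numCollisions (G : Geometry d X) (ε : ℝ) (γ : ℝ → Config N d X) (a b : ℝ) : ℕ :=
  (collisionTimes G ε γ ∩ Icc a b).ncard

omit [Fintype d] in
/-- The velocity flip `(x_i, v_i) ↦ (x_i, -v_i)` of a configuration (time-reversal symmetry of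
the hard-sphere dynamics, CIP 1994 §4.2). [cite: CIP1994, §4.2] -/
def flipVel (z : Config N d X) : Config N d X := fun i => ((z i).1, -(z i).2)

omit [Fintype d] in
/-- Unfolding lemma for the velocity flip. [folklore] -/
@[simp]
theorem flipVel_apply (z : Config N d X) (i : Fin N) : flipVel z i = ((z i).1, -(z i).2) := rfl

omit [Fintype d] in
/-- The velocity flip is an involution. [folklore] -/
@[simp]
theorem flipVel_flipVel (z : Config N d X) : flipVel (flipVel z) = z := by
  funext i
  simp

/-- The velocity flip does not move particles, so it preserves the hard-sphere domain. [folklore] -/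
@[simp]
theorem flipVel_mem_hardSphereDomain_iff {G : Geometry d X} {ε : ℝ} (z : Config N d X) :
    flipVel z ∈ hardSphereDomain G N ε ↔ z ∈ hardSphereDomain G N ε := by
  simp [mem_hardSphereDomain]

/-- The velocity flip preserves the kinetic energy. [folklore] -/
@[simp]
theorem configEnergy_flipVel (z : Config N d X) : configEnergy (flipVel z) = configEnergy z := by
  simp [configEnergy]

/-- The velocity flip exchanges incoming and outgoing pairs. [folklore] -/
theorem isIncoming_flipVel_iff {G : Geometry d X} (z : Config N d X) (i j : Fin N) :
    IsIncoming G (flipVel z) i j ↔ IsOutgoing G z i j := by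
  simp only [IsIncoming, IsOutgoing, flipVel_apply, ← neg_sub', inner_neg_right,
    neg_neg_iff_pos]

/-- The velocity flip commutes with the elastic collision of a pair (the reflection law is
linear in the velocities). The hypothesis `i ≠ j` is needed: `collidePair_apply_left` requires
it (for `i = j` the value of `collidePair` is a junk value). [folklore] -/
theorem collidePair_flipVel {G : Geometry d X} {i j : Fin N} (hij : i ≠ j) (z : Config N d X) :
    collidePair G i j (flipVel z) = flipVel (collidePair G i j z) := by
  have hr : ∀ (n v w : EuclideanSpace ℝ d),
      reflectVel n (-v, -w) = (-(reflectVel n (v, w)).1, -(reflectVel n (v, w)).2) := by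
    intro n v w
    simp only [reflectVel, neg_sub_neg, inner_sub_left, sub_div, sub_smul, Prod.mk.injEq]
    constructor <;> abel
  funext k
  by_cases hkj : k = j
  · subst hkj
    simp only [flipVel_apply, collidePair_apply_right, hr]
  by_cases hki : k = i
  · subst hki
    simp only [flipVel_apply, collidePair_apply_left hkj, hr]
  simp only [flipVel_apply, collidePair_apply_of_ne hki hkj]

/-! ## Hard-sphere trajectories -/

section Trajectory

variable [TopologicalSpace X]

/-- `γ : ℝ → Config N d X` is a *hard-sphere trajectory* of `N` spheres of diameter `ε` in the
geometry `G` (GST 2013 §1.1 and §4.1, Def. 4.1.2; CIP 1994 §4.2): it lives in the hard-sphere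
domain, has locally finitely many collision times, continuous positions, is free flight on every
collision-free interval `(s, t]`, and at a collision time exactly one pair `{i, j}` is in contact,
the left limit `z⁻` exists and is pre-collisional (`IsIncoming`, no grazing) and
`γ t = collidePair G i j z⁻` (elastic jump; the trajectory is right-continuous). [cite: GST2013, §4.1 Def. 4.1.2] -/
structure IsHardSphereTrajectory (G : Geometry d X) (ε : ℝ) (N : ℕ) (γ : ℝ → Config N d X) :
    Prop where
  /-- The trajectory stays in the hard-sphere domain `D_ε^N`. -/
  mem : ∀ t, γ t ∈ hardSphereDomain G N ε
  /-- Collision times are locally finite. -/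
  locFinite : ∀ a b, (collisionTimes G ε γ ∩ Icc a b).Finite
  /-- Positions are continuous in time. -/
  pos_continuous : ∀ i, Continuous fun t => (γ t i).1
  /-- Free flight on collision-free intervals `(s, t]` (this makes velocities
  right-continuous). -/
  free : ∀ s t, s ≤ t → (∀ τ ∈ Ioc s t, τ ∉ collisionTimes G ε γ) →
    γ t = freeFlight G (t - s) (γ s)
  /-- At a collision time a single pair collides, from a pre-collisional left limit, by the
  elastic law. -/
  binary : ∀ t (i j : Fin N), i ≠ j → γ t ∈ contactSet G N ε i j →
    (∀ i' j' : Fin N, i' ≠ j' → γ t ∈ contactSet G N ε i' j' →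
      ({i', j'} : Finset (Fin N)) = {i, j}) ∧
    ∃ zl, Tendsto γ (𝓝[<] t) (𝓝 zl) ∧ IsIncoming G zl i j ∧ γ t = collidePair G i j zl

omit [Fintype d] in
/-- The time reversal of a curve in phase space: flip the velocities of the left limits of
`τ ↦ γ (-τ)`, i.e. `t ↦ flipVel (leftLim γ (-t))` (CIP 1994 §4.2; the left limit
`Function.leftLim` restores right-continuity at collision times; away from the jump times of
`γ` this is `flipVel (γ (-t))`). [cite: CIP1994, §4.2] -/
def timeReverse (γ : ℝ → Config N d X) (t : ℝ) : Config N d X :=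
  flipVel (Function.leftLim γ (-t))

omit [Fintype d] in
/-- At a time `-t` where `γ` is continuous, the time reversal is `flipVel (γ (-t))`. [folklore] -/
theorem timeReverse_apply_of_continuousAt [T2Space X] {γ : ℝ → Config N d X} {t : ℝ}
    (h : ContinuousAt γ (-t)) : timeReverse γ t = flipVel (γ (-t)) := by
  rw [timeReverse, leftLim_eq_of_tendsto (h.tendsto.mono_left nhdsWithin_le_nhds)]

namespace IsHardSphereTrajectory

variable {G : Geometry d X} {ε : ℝ} {γ γ' : ℝ → Config N d X}

/-- On a hard-sphere trajectory the number of collisions in `[a, b]` is the cardinality of the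
finite set of collision times in `[a, b]`. [folklore] -/
theorem numCollisions_eq (h : IsHardSphereTrajectory G ε N γ) (a b : ℝ) :
    numCollisions G ε γ a b = (h.locFinite a b).toFinset.card := by
  rw [numCollisions, Set.ncard_eq_toFinset_card _ (h.locFinite a b)]

/-- A hard-sphere trajectory with no collision in `(s, t]` is free flight there (restatement of
the `free` field). [folklore] -/
theorem eq_freeFlight (h : IsHardSphereTrajectory G ε N γ) {s t : ℝ} (hst : s ≤ t)
    (hfree : ∀ τ ∈ Ioc s t, τ ∉ collisionTimes G ε γ) : γ t = freeFlight G (t - s) (γ s) :=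
  h.free s t hst hfree

/-- Forward uniqueness of hard-sphere trajectories: two trajectories that agree at time `t₀`
agree at all later times (GST 2013 §4.1; CIP 1994 App. 4.A — the dynamics is deterministic
away from grazing and multiple collisions, which `IsHardSphereTrajectory` excludes). Stated
for a Hausdorff position space: positions before and at a collision are then unique limits, so
collision times, colliding pairs and left limits of the two trajectories coincide (without
`T2Space X` the statement is false). [cite: GST2013, §4.1] -/
def unique : Prop :=
  ∀ [T2Space X] (h : IsHardSphereTrajectory G ε N γ) (h' : IsHardSphereTrajectory G ε N γ') {t₀ : ℝ} (h0 : γ t₀ = γ' t₀),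
    EqOn γ γ' (Ici t₀)

/-- Conservation of kinetic energy along a hard-sphere trajectory (free flight and elastic
collisions both preserve `½ ∑ |v_i|²`; GST 2013 §1.1, CIP 1994 §4.2). [cite: GST2013, §1.1] -/
def configEnergy_eq : Prop :=
  ∀ (h : IsHardSphereTrajectory G ε N γ) (s t : ℝ),
    configEnergy (γ s) = configEnergy (γ t)

/-- Reversibility of the hard-sphere dynamics: the time reversal of a hard-sphere trajectory is
a hard-sphere trajectory (CIP 1994 §4.2; the collision law commutes with the velocity flip and
exchanges incoming and outgoing configurations, `isOutgoing_collidePair_iff`). Stated for a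
Hausdorff position space (left limits are unique) and a geometry whose translation action
`v ↦ G.translate x v` is continuous (so that on a collision-free stretch the left limit of the
positions is the algebraic free-flight value; both hold for `ℝ^d` and `T^d`). Without these
hypotheses the reversed curve may violate the `free` field. [cite: CIP1994, §4.2] -/
def timeReverse : Prop :=
  ∀ [T2Space X] (hG : ∀ x : X, Continuous (G.translate x)) (h : IsHardSphereTrajectory G ε N γ),
    IsHardSphereTrajectory G ε N (FluidPDE.timeReverse γ)

end IsHardSphereTrajectory

end Trajectory

/-! ## The hard-sphere flow (Alexander's theorem as a hypothesis structure) -/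

section Flow

variable [MeasureSpace X] [TopologicalSpace X]

/-- The global hard-sphere flow of `N` spheres of diameter `ε` in the geometry `G`, bundled with
its defining properties (Alexander 1975; GST 2013 Prop. 4.1.1; CIP 1994 §4.2, App. 4.A): a
measurable, invariant, Liouville-conull *good set* `good ⊆ D_ε^N` of initial data (no grazing,
no multiple collisions, finitely many collisions in finite time), on which `flow` is a
one-parameter group of hard-sphere trajectories, each `flow t` being measurable and preserving
the Liouville measure. Outside `good` the values of `flow` are unspecified (junk). [cite: Alexander1975] -/
structure HardSphereFlow (G : Geometry d X) (ε : ℝ) (N : ℕ) where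
  /-- The flow map `(t, z) ↦ Φ_t z`. -/
  flow : ℝ → Config N d X → Config N d X
  /-- The good set of initial data on which the dynamics is globally defined. -/
  good : Set (Config N d X)
  /-- The good set is measurable. -/
  measurableSet_good : MeasurableSet good
  /-- The good set lies in the hard-sphere domain. -/
  good_subset : good ⊆ hardSphereDomain G N ε
  /-- The good set has full Liouville measure. -/
  measure_compl_good : liouville G N ε goodᶜ = 0
  /-- The good set is invariant under the flow. -/
  mapsTo_good : ∀ t, MapsTo (flow t) good good
  /-- `Φ_0 = id` on the good set. -/
  flow_zero : ∀ z ∈ good, flow 0 z = z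
  /-- The group property `Φ_{s+t} = Φ_s ∘ Φ_t` on the good set. -/
  flow_add : ∀ s t, ∀ z ∈ good, flow (s + t) z = flow s (flow t z)
  /-- Each time-`t` map is measurable. -/
  measurable_flow : ∀ t, Measurable (flow t)
  /-- Orbits of good points are hard-sphere trajectories. -/
  isTrajectory : ∀ z ∈ good, IsHardSphereTrajectory G ε N fun t => flow t z
  /-- Each time-`t` map preserves the Liouville measure (GST 2013 Prop. 4.1.1). -/
  measurePreserving : ∀ t, MeasurePreserving (flow t) (liouville G N ε) (liouville G N ε)

namespace HardSphereFlow

variable {G : Geometry d X} {ε : ℝ}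

/-- A hard-sphere flow coerces to its flow map `ℝ → Config N d X → Config N d X`. [folklore] -/
instance instCoeFun : CoeFun (HardSphereFlow G ε N) fun _ => ℝ → Config N d X → Config N d X :=
  ⟨HardSphereFlow.flow⟩

/-- Liouville-almost every configuration is good. [folklore] -/
theorem ae_mem_good (Φ : HardSphereFlow G ε N) : ∀ᵐ z ∂liouville G N ε, z ∈ Φ.good :=
  Φ.measure_compl_good

/-- The transport of an (extended nonnegative) density along the flow:
`(S_t W)(z) = W (Φ_{-t} z)` — the density at time `t` of the law of `Φ_t` applied to an initial
datum of density `W` (Liouville equation in mild form; GST 2013 §4.2, CIP 1994 §4.2). [cite: GST2013, §4.2] -/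
def transportDensity (Φ : HardSphereFlow G ε N) (W : Config N d X → ℝ≥0∞) (t : ℝ) :
    Config N d X → ℝ≥0∞ :=
  fun z => W (Φ.flow (-t) z)

/-- The transport of a real function along the flow: `(S_t W)(z) = W (Φ_{-t} z)` (real-valued
twin of `transportDensity`, used for the BBGKY hierarchy; GST 2013 §4.2–4.3). [cite: GST2013, §4.2–4.3] -/
def transportFn (Φ : HardSphereFlow G ε N) (W : Config N d X → ℝ) (t : ℝ) : Config N d X → ℝ :=
  fun z => W (Φ.flow (-t) z)

/-- Unfolding lemma for `transportDensity`. [folklore] -/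
@[simp]
theorem transportDensity_apply (Φ : HardSphereFlow G ε N) (W : Config N d X → ℝ≥0∞) (t : ℝ)
    (z : Config N d X) : Φ.transportDensity W t z = W (Φ.flow (-t) z) := rfl

/-- Unfolding lemma for `transportFn`. [folklore] -/
@[simp]
theorem transportFn_apply (Φ : HardSphereFlow G ε N) (W : Config N d X → ℝ) (t : ℝ)
    (z : Config N d X) : Φ.transportFn W t z = W (Φ.flow (-t) z) := rfl

/-- The law at time `t` of the hard-sphere system started from the initial law `P₀`: the
push-forward `(Φ_t)_* P₀` (GST 2013 §4.2). [cite: GST2013, §4.2] -/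
def lawAt (Φ : HardSphereFlow G ε N) (P₀ : Measure (Config N d X)) (t : ℝ) :
    Measure (Config N d X) :=
  P₀.map (Φ.flow t)

/-- Unfolding lemma for `lawAt`. [folklore] -/
@[simp]
theorem lawAt_eq (Φ : HardSphereFlow G ε N) (P₀ : Measure (Config N d X)) (t : ℝ) :
    Φ.lawAt P₀ t = P₀.map (Φ.flow t) := rfl

/-- On the good set `Φ_{-t}` inverts `Φ_t`. [folklore] -/
theorem flow_neg_flow (Φ : HardSphereFlow G ε N) (t : ℝ) {z : Config N d X} (hz : z ∈ Φ.good) :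
    Φ.flow (-t) (Φ.flow t z) = z := by
  rw [← Φ.flow_add (-t) t z hz, neg_add_cancel, Φ.flow_zero z hz]

/-- The Liouville measure is invariant: the law at time `t` of the Liouville measure is the
Liouville measure (restatement of `measurePreserving`). [folklore] -/
theorem lawAt_liouville (Φ : HardSphereFlow G ε N) (t : ℝ) :
    Φ.lawAt (liouville G N ε) t = liouville G N ε :=
  (Φ.measurePreserving t).map_eq

/-- Transport of densities (mild Liouville equation): the law at time `t` of an absolutely
continuous initial law `W · dZ` is `W ∘ Φ_{-t} · dZ` (GST 2013 §4.2, Prop. 4.1.1: `Φ_t`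
preserves the Liouville measure; CIP 1994 §4.2). [cite: GST2013, Prop. 4.1.1] -/
def lawAt_withDensity : Prop :=
  ∀ (Φ : HardSphereFlow G ε N) {W : Config N d X → ℝ≥0∞} (hW : Measurable W) (t : ℝ),
    Φ.lawAt ((liouville G N ε).withDensity W) t =
      (liouville G N ε).withDensity (Φ.transportDensity W t)

/-- Uniqueness of the hard-sphere flow: two hard-sphere flows agree Liouville-almost everywhere
at every time (GST 2013 Prop. 4.1.1; from `IsHardSphereTrajectory.unique` and the group
property; Hausdorff position space as in `IsHardSphereTrajectory.unique`). [cite: GST2013, Prop. 4.1.1] -/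
def flow_eq_ae : Prop :=
  ∀ [T2Space X] (Φ Ψ : HardSphereFlow G ε N) (t : ℝ),
    Φ.flow t =ᵐ[liouville G N ε] Ψ.flow t

end HardSphereFlow

/-- **Alexander's theorem** in `ℝ^d` (Alexander 1975; GST 2013 Prop. 4.1.1; CIP 1994 App. 4.A):
for spheres of positive diameter the hard-sphere flow exists, i.e. outside a Liouville-null set
of initial data (leading to grazing or multiple collisions, or to infinitely many collisions in
finite time) the dynamics is globally well defined, measurable and preserves the Liouville
measure. [cite: Alexander1975] -/
def HardSphereFlow.nonempty : Prop :=
  ∀ {ε : ℝ} (hε : 0 < ε) (N : ℕ),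
    Nonempty (HardSphereFlow (Euclidean.geometry d) ε N)

/-- **Alexander's theorem** on the flat torus `T^d` (Alexander 1975; GST 2013 Prop. 4.1.1;
Bodineau–Gallagher–Saint-Raymond–Simonella work on `T^d`): for `0 < ε < 1/2` (so that the
contact condition `|x_i - x_j| = ε` only involves the minimal image) the hard-sphere flow on
`(T^d × ℝ^d)^N` exists. [cite: Alexander1975] -/
def HardSphereFlow.nonempty_torus : Prop :=
  ∀ {ε : ℝ} (hε : 0 < ε) (hε' : ε < 2⁻¹) (N : ℕ),
    Nonempty (HardSphereFlow (Torus.geometry d) ε N)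

end Flow

end Kinetic

end

end Literature.Analysis.FluidPDE
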